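import Literature.AlgebraicGeometry.Resolution.QuadraticTransformsStructure
import Literature.AlgebraicGeometry.Resolution.QuadraticTransformsProofs
import Literature.AlgebraicGeometry.Resolution.BaseTreeFiniteKonig
import Literature.AlgebraicGeometry.Resolution.QuadraticTransformWeakTransform
import Mathlib.RingTheory.DiscreteValuationRing.Basic
import HarnessLib

/-!
# [OURS · L1 W4.6 rung (i-a)] Thread chains: the local algebra of a chain of infinitely near singular points of
# `(J, b)` on a surface — the structure, the transform law, the curve/point cases
# (cell res-hironaka, LADDER-RESOLUTION rung L, D-0089; campaign s46, prover res-L1-s46-pv-1; host route MarkedTransfer,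
# `--supports stmt-ResolutionOfSingularities-16155`)

HONEST FRAMING. Nothing here is a statement of H. Hironaka's manuscript (2017-03-23, [Hironaka2017]) and nothing here
asserts that any statement of it holds. This is PURE COMMUTATIVE ALGEBRA inside a field `F`, over the tree's theory of
quadratic transforms (`Resolution/QuadraticTransforms*.lean`: `IsQuadraticTransform`, `IsQuadraticTransformAlong`,
`AbhyankarQuadraticUnion_holds`; `BaseTreeFiniteKonig.lean`: Chevalley for chains). It is the local form of the one open
theorem of rung (i-a) (`CampaignW46.PlaneIsolatedNoHitThread`, `MarkedTransferCampaignW46IsolatedThread.lean`): a hit thread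
of an infinite permissible sequence with isolated singular locus on a surface gives, after forgetting the stages at which the
thread is not blown up, a THREAD CHAIN in the function field (`IsThreadChain`, below; the passage from schemes to this
structure is a separate file). AI review is weaker than expert review. No `sorry`; axioms standard.

## The structure (what a hit thread leaves in the function field `F = K(Z₀)`)

`IsThreadChain b R J`: local rings `R k ⊆ F` (the local rings `𝒪_{Z_k, y_k}` of the thread, read in `F`), each a regular
local ring of Krull dimension `≤ 2`, `R 0` with fraction field `F`, each `R (k+1)` a QUADRATIC TRANSFORM of `R k`; ideals
`J k` of `R k` (the stalks of the ideals of the transforms `E_k = (J_k, b)`), non-zero, with the TRANSFORM LAW of Def. 2.1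
read in the stalk: `J (k+1) = (J k · R (k+1) : (𝔪_k R (k+1))^b)`; the thread is SINGULAR: `J k ⊆ 𝔪_k^b`; the singular
locus is ISOLATED at every stage: for every prime element `π` of `R k` generating a non-maximal prime, `J k ⊄ (π^b)` (no
curve through `y_k` lies in `Sing(E_k)`); and the quotients `R k / P` have module-finite normalization (the stalks are
essentially of finite type over the base field).

## Contents (this file)

* `IsThreadChain` and bookkeeping (`le`, `mono`, `dominates`, `isLocalRingOf`, the product form of the transform law
  `(x^b) · J (k+1) = J k · R (k+1)` for a generator `x` of `𝔪_k R (k+1)`, and conversely `transform_of_span_pow_mul_eq` for the bridge).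
* **The curve and point cases** (`false_of_ringKrullDim_le_one`): if some `R k` has dimension `≤ 1` the chain is
  impossible — a field has `𝔪^b = 0 ∌ J`, and a discrete valuation ring is its own quadratic transform, where the
  transform law lowers the `𝔪`-adic exponent of `J` by `b ≥ 1` at every stage.

The valuation ring of the chain, `O = ⋃ R k` and principalization are in the companion
`MarkedTransferCampaignW46ThreadChainValuation.lean`; the end game (the followed-curve case and the exceptional case) in
`MarkedTransferCampaignW46ThreadChainFollowed.lean` / `…ThreadChainExceptional.lean`.

## References

* O. Zariski, P. Samuel, *Commutative Algebra* II (1960), Appendix 5. [ZariskiSamuel1960]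
* S. S. Abhyankar, Amer. J. Math. 78 (1956), Lemma 12, Thm. 3. [Abhyankar1956Valuations]
* companion modules of this campaign: `MarkedTransferCampaignW46IsolatedThread.lean` (p478766), `…PlaneIsolated.lean`.
-/

noncomputable section

set_option linter.dupNamespace false -- mandated namespace of this single-conjunct summit

open IsLocalRing

namespace Summit.ResolutionOfSingularities.ResolutionOfSingularities.Theorems

namespace CampaignW46

open Literature.AlgebraicGeometry.Resolution

universe u

variable {F : Type u} [Field F]

/-! ## Thread chains -/

/-- [OURS · L1 W4.6 rung (i-a)] NOT a statement of the manuscript. **A thread chain with exponent `b`** in the field `F`: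
local rings `R k ⊆ F`, regular of dimension `≤ 2`, `R 0` with fraction field `F`, `R (k+1)` a quadratic transform of
`R k`; non-zero ideals `J k ⊆ 𝔪_k^b` of `R k` obeying the transform law `J (k+1) = (J k R (k+1) : (𝔪_k R (k+1))^b)`
(Def. 2.1 read in the stalks along a chain of infinitely near points, each blown up); isolated singular locus: `J k ⊄ (π^b)`
for every prime element `π` of `R k` with `(π) ≠ 𝔪_k`; and module-finite normalizations of the quotient domains of the
`R k` (excellence of the stalks, used for the followed-curve case). [folklore] -/
structure IsThreadChain (b : ℕ) (R : ℕ → Subring F) (J : ∀ k, Ideal (R k)) : Prop where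
  /-- `b > 0` -/
  b_pos : 0 < b
  /-- `Frac (R 0) = F` -/
  isLocalRingOf : IsLocalRingOf (R 0)
  /-- every `R k` is a regular local ring -/
  isRegularLocalRing : ∀ k, IsRegularLocalRing (R k)
  /-- of Krull dimension at most two -/
  ringKrullDim_le : ∀ k, ringKrullDim (R k) ≤ 2
  /-- `R (k+1)` is a quadratic transform of `R k` -/
  isQuadraticTransform : ∀ k, IsQuadraticTransform (R k) (R (k + 1))
  /-- the transform law `J (k+1) = (J k R (k+1) : (𝔪_k R (k+1))^b)` -/
  transform : ∀ k (z : R (k + 1)), z ∈ J (k + 1) ↔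
    ∀ w ∈ (extIdeal (@maximalIdeal (R k) _ (isRegularLocalRing k).toIsLocalRing) (R (k + 1))) ^ b,
      z * w ∈ extIdeal (J k) (R (k + 1))
  /-- `J k ≠ 0` -/
  ne_bot : ∀ k, J k ≠ ⊥
  /-- the thread is singular: `J k ⊆ 𝔪_k^b` -/
  le_pow : ∀ k, J k ≤ (@maximalIdeal (R k) _ (isRegularLocalRing k).toIsLocalRing) ^ b
  /-- isolated singular locus: no height-one prime `(π) ≠ 𝔪_k` has `J k ⊆ (π^b)` -/
  not_le_span_pow : ∀ k (π : R k), Prime π →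
    Ideal.span {π} ≠ @maximalIdeal (R k) _ (isRegularLocalRing k).toIsLocalRing → ¬ J k ≤ Ideal.span {π ^ b}
  /-- module-finite normalization of the quotient domains -/
  finite_integralClosure : ∀ k (P : Ideal (R k)), P.IsPrime →
    Module.Finite (R k ⧸ P) (integralClosure (R k ⧸ P) (FractionRing (R k ⧸ P)))

namespace IsThreadChain

variable {b : ℕ} {R : ℕ → Subring F} {J : ∀ k, Ideal (R k)} (h : IsThreadChain b R J)
include h

/-- `R k ≤ R (k+1)`. [folklore] -/
theorem le_succ (k : ℕ) : R k ≤ R (k + 1) := (h.isQuadraticTransform k).dominates.1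

/-- The chain is monotone. [folklore] -/
theorem mono : Monotone R := monotone_nat_of_le_succ h.le_succ

/-- `R k` dominates `R 0`… precisely `R j` dominates `R i` for `i ≤ j`. [folklore] -/
theorem dominates {i j : ℕ} (hij : i ≤ j) : SubringDominates (R i) (R j) := by
  induction hij with
  | refl => exact SubringDominates.refl _
  | step _ ih => exact ih.trans (h.isQuadraticTransform _).dominates

/-- Every `R k` has fraction field `F`. [folklore] -/
theorem isLocalRingOf' (k : ℕ) : IsLocalRingOf (R k) := by
  haveI := (h.isRegularLocalRing k).toIsLocalRing
  exact isLocalRingOf_of_le h.isLocalRingOf (h.mono (Nat.zero_le k))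

/-! ## A generator of `𝔪_k R (k+1)` and the product form of the transform law -/

/-- **The chart element**: some non-zero `x ∈ 𝔪_k` with `R k[𝔪_k/x] ⊆ R (k+1)`; then `𝔪_k R (k+1) = x R (k+1)`.
[cite: Cutkosky2014, §2.1] -/
theorem exists_generator (k : ℕ) : ∃ (x : F) (hx : x ∈ R k), x ≠ 0 ∧
    (haveI := (h.isRegularLocalRing k).toIsLocalRing; (⟨x, hx⟩ : R k) ∈ maximalIdeal (R k)) ∧
    (haveI := (h.isRegularLocalRing k).toIsLocalRing; blowupRing (R k) x ≤ R (k + 1)) ∧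
    ∃ hx1 : x ∈ R (k + 1), (haveI := (h.isRegularLocalRing k).toIsLocalRing;
      extIdeal (maximalIdeal (R k)) (R (k + 1))) = Ideal.span {(⟨x, hx1⟩ : R (k + 1))} := by
  haveI := (h.isRegularLocalRing k).toIsLocalRing
  obtain ⟨_, x, hxm, hx0, -, hT, -, -⟩ := h.isQuadraticTransform k
  have hx0' : (x : F) ≠ 0 := fun e => hx0 (Subtype.ext e)
  have hx1 : (x : F) ∈ R (k + 1) := h.le_succ k x.2
  refine ⟨x, x.2, hx0', hxm, hT, hx1, ?_⟩
  rw [extIdeal_eq_map _ (h.le_succ k)]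
  apply le_antisymm
  · rw [Ideal.map_le_iff_le_comap]
    intro y hy
    rw [Ideal.mem_comap, Ideal.mem_span_singleton']
    refine ⟨⟨(y : F) / x, hT (div_mem_blowupRing _ hy)⟩, Subtype.ext ?_⟩
    change (y : F) / x * x = y
    rw [div_mul_cancel₀ _ hx0']
  · rw [Ideal.span_singleton_le_iff_mem]
    exact Ideal.mem_map_of_mem (Subring.inclusion (h.le_succ k)) hxm

/-- **Product form of the transform law**: if `𝔪_k R (k+1) = x R (k+1)` then `x^b · J (k+1) = J k · R (k+1)` (the colon
by the principal ideal `(x^b) ⊇ J k R (k+1)` is multiplication by `x^{-b}`). [folklore] -/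
theorem span_pow_mul_eq (k : ℕ) {x : F} (hx1 : x ∈ R (k + 1))
    (hmx : (haveI := (h.isRegularLocalRing k).toIsLocalRing;
      extIdeal (maximalIdeal (R k)) (R (k + 1))) = Ideal.span {(⟨x, hx1⟩ : R (k + 1))}) :
    Ideal.span {(⟨x, hx1⟩ : R (k + 1)) ^ b} * J (k + 1) = extIdeal (J k) (R (k + 1)) := by
  haveI := (h.isRegularLocalRing k).toIsLocalRing
  set X : R (k + 1) := ⟨x, hx1⟩ with hX
  -- `J k R (k+1) ⊆ 𝔪_k^b R (k+1) = (x^b)`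
  have hsub : extIdeal (J k) (R (k + 1)) ≤ Ideal.span {X ^ b} := by
    rw [extIdeal_eq_map _ (h.le_succ k)]
    refine (Ideal.map_mono (h.le_pow k)).trans ?_
    rw [Ideal.map_pow, ← extIdeal_eq_map _ (h.le_succ k), hmx, Ideal.span_singleton_pow]
  apply le_antisymm
  · rw [Ideal.span_singleton_mul_le_iff]
    intro z hz
    have hzX : X ^ b * z = z * X ^ b := mul_comm _ _
    rw [hzX]
    exact (h.transform k z).mp hz _ (by rw [hmx, Ideal.span_singleton_pow]; exact Ideal.mem_span_singleton_self _)
  · intro y hy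
    obtain ⟨z, rfl⟩ := Ideal.mem_span_singleton'.mp (hsub hy)
    have hzX : z * X ^ b = X ^ b * z := mul_comm _ _
    rw [hzX]
    refine Ideal.mul_mem_mul (Ideal.mem_span_singleton_self _) ((h.transform k z).mpr fun w hw => ?_)
    rw [hmx, Ideal.span_singleton_pow] at hw
    obtain ⟨c, rfl⟩ := Ideal.mem_span_singleton'.mp hw
    have : z * (c * X ^ b) = c * (z * X ^ b) := by ring
    rw [this]
    exact Ideal.mul_mem_left _ _ hy

end IsThreadChain

/-- For the bridge: the colon form of the transform law from the product form — if `(x^b) · J' = N` with `M = (x)`,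
`x ≠ 0`, then `z ∈ J' ↔ ∀ w ∈ M^b, z w ∈ N`. [folklore] -/
theorem transform_of_span_pow_mul_eq {R' : Subring F} (M N J' : Ideal R') (x : R') (hx0 : x ≠ 0) (b : ℕ)
    (hM : M = Ideal.span {x}) (hJ : Ideal.span {x ^ b} * J' = N) (z : R') :
    z ∈ J' ↔ ∀ w ∈ M ^ b, z * w ∈ N := by
  have hxb0 : x ^ b ≠ 0 := pow_ne_zero b hx0
  constructor
  · intro hz w hw
    rw [hM, Ideal.span_singleton_pow] at hw
    obtain ⟨c, rfl⟩ := Ideal.mem_span_singleton'.mp hw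
    have e : z * (c * x ^ b) = x ^ b * (c * z) := by ring
    rw [← hJ, e]
    exact Ideal.mul_mem_mul (Ideal.mem_span_singleton_self _) (Ideal.mul_mem_left _ _ hz)
  · intro hz
    have hxb : x ^ b ∈ M ^ b := by rw [hM, Ideal.span_singleton_pow]; exact Ideal.mem_span_singleton_self _
    have h1 : x ^ b * z ∈ Ideal.span {x ^ b} * J' := by rw [hJ, mul_comm]; exact hz (x ^ b) hxb
    obtain ⟨z', hz', he⟩ := Ideal.mem_span_singleton_mul.mp h1
    have : z' = z := mul_left_cancel₀ hxb0 he
    exact this ▸ hz'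

/-- A local subring of `F` containing a valuation ring `V` of `F` and dominating it equals it. [folklore] -/
theorem eq_of_subringDominates_of_forall_mem_or_inv_mem
    {V S : Subring F} (hV : ∀ z : F, z ∈ V ∨ z⁻¹ ∈ V) (hdom : SubringDominates V S) : S = V := by
  refine le_antisymm (fun z hz => ?_) hdom.1
  rcases hV z with hzV | hzV
  · exact hzV
  · by_cases hz0 : z = 0
    · rw [hz0]; exact V.zero_mem
    · have : z⁻¹⁻¹ ∈ V := hdom.2 _ hzV (by rw [inv_inv]; exact hz)
      rwa [inv_inv] at this

namespace IsThreadChain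

variable {b : ℕ} {R : ℕ → Subring F} {J : ∀ k, Ideal (R k)} (h : IsThreadChain b R J)
include h

/-! ## The curve and point cases -/

/-- **No thread chain has a member of dimension `≤ 1`.** A regular local ring of dimension `≤ 1` is a field or a
discrete valuation ring: a field has `J k ⊆ 𝔪^b = 0`; a discrete valuation ring `V` of `F` is dominated by, hence equal
to, all later members, and there the transform law reads `x^b · J (k+1) = J k · V` with `x ∈ 𝔪_V`, so the exponents
`n_k` (`J k = 𝔪^{n_k}`) would satisfy `n_{k+1} + b ≤ n_k` forever. [folklore] -/
theorem false_of_ringKrullDim_le_one {k₀ : ℕ} (hk₀ : ringKrullDim (R k₀) ≤ 1) : False := by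
  classical
  haveI hreg := h.isRegularLocalRing k₀
  haveI : IsPrincipalIdealRing (R k₀) := isPrincipalIdealRing_of_ringKrullDim_le_one hk₀
  have hb : 0 < b := h.b_pos
  -- not a field: else `J k₀ ⊆ 𝔪^b = ⊥`
  have hmne : maximalIdeal (R k₀) ≠ ⊥ := by
    intro hm
    apply h.ne_bot k₀
    have h1 := h.le_pow k₀
    rw [hm, ← Ideal.zero_eq_bot, zero_pow hb.ne', Ideal.zero_eq_bot] at h1
    exact le_bot_iff.mp h1
  haveI hdvr : IsDiscreteValuationRing (R k₀) :=
    { not_a_field' := hmne }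
  -- `R k₀` is a valuation ring of `F`
  haveI : ValuationRing (R k₀) := inferInstance
  have hval : ∀ z : F, z ∈ R k₀ ∨ z⁻¹ ∈ R k₀ := by
    intro z
    obtain ⟨a, ha, c, hc, hc0, rfl⟩ := (h.isLocalRingOf' k₀).2 z
    obtain ⟨e, he⟩ := ValuationRing.cond (⟨a, ha⟩ : R k₀) ⟨c, hc⟩
    rcases he with he | he
    · -- `a e = c`: `z = a / (a e)`
      have he' : a * (e : F) = c := by have := congrArg Subtype.val he; simpa using this
      by_cases ha0 : a = 0
      · left; rw [ha0, zero_div]; exact (R k₀).zero_mem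
      · right
        rw [inv_div, ← he', mul_div_cancel_left₀ _ ha0]
        exact e.2
    · -- `c e = a`: `z = e`
      have he' : c * (e : F) = a := by have := congrArg Subtype.val he; simpa using this
      left
      rw [← he', mul_comm, mul_div_assoc, div_self hc0, mul_one]
      exact e.2
  -- all later members equal `R k₀`
  have heq : ∀ j, R (k₀ + j) = R k₀ := by
    intro j
    induction j with
    | zero => rfl
    | succ j ih =>
      have hdom : SubringDominates (R (k₀ + j)) (R (k₀ + j + 1)) := (h.isQuadraticTransform _).dominates
      rw [ih] at hdom
      exact eq_of_subringDominates_of_forall_mem_or_inv_mem hval hdom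
  -- transport the ideals to `V = R k₀`
  let ι : ∀ j, R (k₀ + j) →+* R k₀ := fun j => Subring.inclusion (heq j).le
  have hιinj : ∀ j, Function.Injective (ι j) := fun j => Subring.inclusion_injective _
  let I : ℕ → Ideal (R k₀) := fun j => (J (k₀ + j)).map (ι j)
  have hI0 : ∀ j, I j ≠ ⊥ := fun j hj =>
    h.ne_bot (k₀ + j) ((Ideal.map_eq_bot_iff_of_injective (hιinj j)).mp hj)
  obtain ⟨ϖ, hϖ⟩ := IsDiscreteValuationRing.exists_irreducible (R k₀)
  have hmax : maximalIdeal (R k₀) = Ideal.span {ϖ} :=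
    (IsDiscreteValuationRing.irreducible_iff_uniformizer ϖ).mp hϖ
  have hex : ∀ j, ∃ n : ℕ, I j = Ideal.span {ϖ ^ n} := fun j =>
    IsDiscreteValuationRing.ideal_eq_span_pow_irreducible (hI0 j) hϖ
  choose n hn using hex
  -- the transform law gives `I j ⊆ 𝔪^(b + n (j+1))`
  have hstep : ∀ j, n (j + 1) + b ≤ n j := by
    intro j
    obtain ⟨x, hxR, hx0, hxm, -, hx1, hmx⟩ := h.exists_generator (k₀ + j)
    have hprod := h.span_pow_mul_eq (k₀ + j) hx1 hmx
    -- `x` is a non-unit of `V`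
    haveI : IsLocalRing (R (k₀ + j)) := (h.isRegularLocalRing _).toIsLocalRing
    have hxV : (ι (j + 1) ⟨x, hx1⟩) ∈ maximalIdeal (R k₀) := by
      rw [mem_maximalIdeal_iff_inv_not_mem] at hxm ⊢
      rcases hxm with hxm | hxm
      · exact absurd hxm hx0
      · right
        change x⁻¹ ∉ R k₀
        rwa [← heq j]
    have hle : I j ≤ maximalIdeal (R k₀) ^ (b + n (j + 1)) := by
      change (J (k₀ + j)).map (ι j) ≤ _
      rw [Ideal.map_le_iff_le_comap]
      intro y hy
      rw [Ideal.mem_comap]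
      have hyext : Subring.inclusion (h.le_succ (k₀ + j)) y ∈ extIdeal (J (k₀ + j)) (R (k₀ + j + 1)) := by
        rw [extIdeal_eq_map _ (h.le_succ _)]; exact Ideal.mem_map_of_mem _ hy
      rw [← hprod, Ideal.mem_span_singleton_mul] at hyext
      obtain ⟨z, hz, hzy⟩ := hyext
      have e1 : ι j y = (ι (j + 1) ⟨x, hx1⟩) ^ b * ι (j + 1) z := by
        apply Subtype.ext
        change (y : F) = x ^ b * (z : F)
        have := congrArg Subtype.val hzy
        simp only [Subring.coe_mul, SubmonoidClass.coe_pow] at this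
        exact this.symm
      rw [e1, pow_add]
      refine Ideal.mul_mem_mul (Ideal.pow_mem_pow hxV b) ?_
      have hz' : ι (j + 1) z ∈ I (j + 1) := Ideal.mem_map_of_mem _ hz
      rw [hn (j + 1), ← Ideal.span_singleton_pow, ← hmax] at hz'
      exact hz'
    rw [hn j, hmax, Ideal.span_singleton_pow, Ideal.span_singleton_le_span_singleton] at hle
    have := (pow_dvd_pow_iff hϖ.ne_zero hϖ.not_isUnit).mp hle
    omega
  -- descent
  have hdec : ∀ j, n j + j * b ≤ n 0 := by
    intro j
    induction j with
    | zero => simp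
    | succ j ih => have := hstep j; rw [Nat.succ_mul]; omega
  have hfin := hdec (n 0 + 1)
  have : n 0 + 1 ≤ (n 0 + 1) * b := Nat.le_mul_of_pos_right _ hb
  omega

end IsThreadChain

end CampaignW46

end Summit.ResolutionOfSingularities.ResolutionOfSingularities.Theorems

end
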